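import Literature.NumberTheory.EllipticCurves.SemilinearTateDual
import Literature.NumberTheory.EllipticCurves.SelmerGaloisActionPlaces
import Literature.NumberTheory.GaloisCohomology.PoitouTate
import HarnessLib

/-!
# `σ_*` on `H¹(K_v, E[n]^D)` and on `H²(K_v, μ_N)` at the finite places of a number field, and the
# compatibility of the local Tate pairing with `σ_*` (up to the invariant maps)

Companion of `SelmerGaloisActionPlaces.lean` (`conjActPlace : H¹(K_v, E[n]) → H¹(K_{σv}, E[n])`),
`SemilinearLocalCohomology.lean` (`semilinearLocalH`, compatibility with cup products) and
`SemilinearTateDual.lean` (semilinear structures on `μ_N`, `Hom(M, μ_N)`, `E[n]`). With the SAME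
adapted lift `liftAutPlace σ h` at a place datum `h : σ • v = w`:

* `muConjPlace σ N h d : Hᵈ(K_v, μ_N) →+ Hᵈ(K_w, μ_N)` and
  `conjActPlaceDual W σ n N h : H¹(K_v, E[n]^D) →+ H¹(K_w, E[n]^D)` (`E[n]^D = Hom(E[n], μ_N)`);
* `LocalInvariants.IsConjCompatible inv σ` — the (published, here HYPOTHESISED) compatibility of a
  family of local invariant maps with `σ_*`: `inv_w ∘ σ_* = inv_v` on `H²(K_v, μ_N)` (Serre, *Local
  class field theory* in Cassels–Fröhlich, Ch. VI §1.1: `inv` commutes with isomorphisms of local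
  fields); the tree's `LocalInvariants` is an abstract family, so this is a property to assume,
  like `IsPerfect`, `SumLocalTermEqZero`;
* `localTatePairingZMod_conjActPlace` — **`⟨σ_* x, σ_* y⟩_w = ⟨x, y⟩_v`** for the local Tate
  pairing `⟨x, y⟩_v = inv_v(x ∪ y)` under `IsConjCompatible` (`semilinearLocalH_cupProduct` +
  `tateDualEval_semilinear`): the hypothesis `hb` of the sign-by-sign Poitou–Tate counting
  (`Rank1ResidualJetPairingCountingPermutation.sum_pairing_piTransport`), Jetchev 2008 Thm. 5.1
  «with respect to `∑_v ⟨,⟩_v^±`»;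
* `conjActPlaceDual_conjActPlaceDual` — round trip for `σ² = 1`;
* `semilinearH_one_eq_of_divGal` — **independence of the lift** for the global semilinear action in
  degree `1` (two lifts differ by `δ ∈ Γ_K`; inner pairs act trivially), whence the global action
  `conjActDual W σ n N` on `H¹(K, E[n]^D)` and `conjActPlaceDual_localization`:
  `σ_* (loc_v y) = loc_w (σ_* y)`.

Everything is PROVED; no named facts, no instances, no notation.

## References

* J. W. S. Cassels, A. Fröhlich (eds.), *Algebraic Number Theory* (1967), Ch. VI (Serre) §1.1,
  Ch. VII (Tate) §1.1. [CasselsFrohlichANT1967]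
* J. S. Milne, *Arithmetic Duality Theorems* (2006), Ch. I §0, Cor. 2.3. [MilneADT2006]
* D. Jetchev, Compos. Math. 144 (2008), §5 Thm. 5.1. [Jetchev2008]
* J.-P. Serre, *Local Fields* (1979), VII.§5 Prop. 3. [SerreLocalFields1979]
-/

noncomputable section

open scoped Classical
open Field WeierstrassCurve
open Literature.NumberTheory.GaloisRepresentations
open Literature.NumberTheory.GaloisRepresentations.DiscreteGaloisModule (mu MuCarrier TateDual
  tateDualEval localTatePairingZMod)

universe u v

namespace Literature.NumberTheory.EllipticCurves

/-! ### Independence of the lift (degree one) -/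

section LiftIndependence

variable {k : Type v} {K : Type u} [Field k] [Field K] [Algebra k K]
variable {M : Type u} [AddCommGroup M] [TopologicalSpace M] [DiscreteTopology M]
variable {ρ : DiscreteGaloisModule K M} {σ : K ≃ₐ[k] K}
  {τ₁ τ₂ : AlgebraicClosure K ≃+* AlgebraicClosure K}

/-- **The global semilinear action on `H¹(K, M)` does not depend on the lift**: if `ψ₁`, `ψ₂` are
semilinear for two lifts `τ₁`, `τ₂` of the same `σ` and `ψ₁ = ψ₂ ∘ ρ(δ)` for `δ = τ₂⁻¹ τ₁ ∈ Γ_K`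
(`IsLiftOfAut.divGal`), then `semilinearH … ψ₁ … 1 = semilinearH … ψ₂ … 1` — the two compatible pairs
differ by the inner pair of `δ`, and `g ↦ δ f(δ⁻¹ g δ)` is `f` plus the coboundary of `f δ`.
[cite: SerreLocalFields1979, VII.§5 Prop. 3] -/
theorem semilinearH_one_eq_of_divGal (hτ₁ : IsLiftOfAut σ τ₁) (hτ₂ : IsLiftOfAut σ τ₂)
    {ψ₁ ψ₂ : M →+ M} (hψ₁ : IsSemilinear ρ hτ₁ ψ₁) (hψ₂ : IsSemilinear ρ hτ₂ ψ₂)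
    (h12 : ∀ m, ψ₁ m = ψ₂ (ρ (hτ₁.divGal hτ₂) m)) (c : galoisCohomology ρ 1) :
    semilinearH hτ₁ ψ₁ hψ₁ 1 c = semilinearH hτ₂ ψ₂ hψ₂ 1 c := by
  set δ := hτ₁.divGal hτ₂ with hδ
  obtain ⟨f, rfl⟩ := oneCocycleClass_surjective ρ.toTopRep c
  have h1 : semilinearH hτ₁ ψ₁ hψ₁ 1 (oneCocycleClass _ f) =
      oneCocycleClass _ (contOneCocycles.pullback hτ₁.conjGalCMH (semilinearHom hτ₁ ψ₁ hψ₁) f) :=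
    map_oneCocycleClass _ _ _ f
  have h2 : semilinearH hτ₂ ψ₂ hψ₂ 1 (oneCocycleClass _ f) =
      oneCocycleClass _ (contOneCocycles.pullback hτ₂.conjGalCMH (semilinearHom hτ₂ ψ₂ hψ₂) f) :=
    map_oneCocycleClass _ _ _ f
  rw [h1, h2]
  have hgal : ∀ g : absoluteGaloisGroup K,
      hτ₁.conjGalCMH g = δ⁻¹ * (hτ₂.conjGalCMH g * δ) := by
    intro g
    rw [hτ₁.conjGalCMH_eq_conj_comp hτ₂, ContinuousMonoidHom.comp_toFun, conjCMH_apply, mul_assoc]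
  suffices h : oneCocycleClass _ (contOneCocycles.pullback hτ₁.conjGalCMH (semilinearHom hτ₁ ψ₁ hψ₁) f
      - contOneCocycles.pullback hτ₂.conjGalCMH (semilinearHom hτ₂ ψ₂ hψ₂) f) = 0 by
    rwa [oneCocycleClass_sub, sub_eq_zero] at h
  refine (oneCocycleClass_eq_zero_iff _ _).mpr ⟨ψ₂ (f.1 δ), fun g => ?_⟩
  rw [Submodule.coe_sub, ContinuousMap.sub_apply, contOneCocycles.pullback_apply,
    contOneCocycles.pullback_apply]
  change ψ₁ (f.1 (hτ₁.conjGalCMH g)) - ψ₂ (f.1 (hτ₂.conjGalCMH g)) =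
    ρ.toTopRep.ρ g (ψ₂ (f.1 δ)) - ψ₂ (f.1 δ)
  rw [h12, hgal]
  change ψ₂ (ρ.toTopRep.ρ δ (f.1 (δ⁻¹ * (hτ₂.conjGalCMH g * δ)))) - _ = _
  rw [contOneCocycles.apply_smul_inv_mul, f.2 (hτ₂.conjGalCMH g) δ, map_sub, map_add]
  have hkey : ψ₂ (ρ.toTopRep.ρ (hτ₂.conjGalCMH g) (f.1 δ)) = ρ.toTopRep.ρ g (ψ₂ (f.1 δ)) :=
    hψ₂ _ _
  rw [hkey]
  abel

end LiftIndependence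

/-! ### The place data: `σ_*` on `H¹(K_v, E[n]^D)` and on `Hᵈ(K_v, μ_N)` -/

section Places

open NumberField IsDedekindDomain Literature.NumberTheory.Automorphic
open Literature.NumberTheory.GaloisCohomology

variable {K : Type u} [Field K] [NumberField K] (W : WeierstrassCurve ℚ) (σ : K ≃ₐ[ℚ] K)
  (n : ℤ) (N : ℕ)

/-- **`σ_* : Hᵈ(K_v, μ_N) → Hᵈ(K_w, μ_N)`** at a place datum `σ • v = w`, along the adapted lift
`liftAutPlace σ h` acting on `μ_N` (`muSemilinearMap`). For `d = 2` this is the map the invariant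
maps must be compatible with (`LocalInvariants.IsConjCompatible`).
[cite: CasselsFrohlichANT1967, Ch. VI §1.1 and Ch. VII §1.1] -/
def muConjPlace {v w : HeightOneSpectrum (𝓞 K)} (h : σ • v = w) (d : ℕ) :
    galoisCohomology ((mu K N).toLocal (Sum.inr v : Place K)) d →+
      galoisCohomology ((mu K N).toLocal (Sum.inr w : Place K)) d :=
  semilinearLocalH (ρ := mu K N) (E := v.adicCompletion K) (E' := w.adicCompletion K)
    (isLiftOfAut_liftAutPlace σ h)
    (isLiftOfRingEquiv_ringEquivLift (galAdicCompletionEquiv (L := K) σ h))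
    (liftsCommute_liftAutPlace σ h) (muSemilinearMap (liftAutPlace σ h) N)
    (isSemilinear_mu (isLiftOfAut_liftAutPlace σ h) N) d

/-- The `τ`-semilinear endomorphism `f ↦ τ ∘ f ∘ τ⁻¹` of `E[n]^D = Hom(E[n], μ_N)` for a lift `τ`
of `σ`. [cite: MilneADT2006, Ch. I §0] -/
def tateDualTorsionSemilinearMap {τ : AlgebraicClosure K ≃+* AlgebraicClosure K}
    (hτ : IsLiftOfAut σ τ) :
    TateDual K (geomTorsion (W.baseChange K) n) N →+ TateDual K (geomTorsion (W.baseChange K) n) N :=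
  tateDualSemilinearMap N (muSemilinearMap τ N) (hτ.symm_isLiftOfAut.torsionMap W n)

variable [Finite (geomTorsion (W.baseChange K) n)]

/-- `tateDualTorsionSemilinearMap` is `τ`-semilinear on `E[n]^D`. [cite: MilneADT2006, Ch. I §0] -/
theorem isSemilinear_tateDualTorsion {τ : AlgebraicClosure K ≃+* AlgebraicClosure K}
    (hτ : IsLiftOfAut σ τ) :
    IsSemilinear (((W.baseChange K).torsionGaloisModule n).tateDual N) hτ
      (tateDualTorsionSemilinearMap W σ n N hτ) :=
  isSemilinear_tateDual (ρ := (W.baseChange K).torsionGaloisModule n) hτ (hτ.torsionMap_smul W n)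
    (hτ.torsionMap_apply_symm W n) (hτ.torsionMap_symm_apply W n) (isSemilinear_mu hτ N)

/-- **`σ_* : H¹(K_v, E[n]^D) → H¹(K_w, E[n]^D)`** at a place datum `σ • v = w` (`E[n]^D = Hom(E[n], μ_N)`
the Tate dual), along the adapted lift `liftAutPlace σ h` acting by `f ↦ τ ∘ f ∘ τ⁻¹`; the companion of
`conjActPlace` on the dual side of local Tate duality. [cite: MilneADT2006, Ch. I §0, Cor. 2.3]
[cite: Jetchev2008, §5 Thm. 5.1] -/
def conjActPlaceDual {v w : HeightOneSpectrum (𝓞 K)} (h : σ • v = w) :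
    galoisCohomology ((((W.baseChange K).torsionGaloisModule n).tateDual N).toLocal
        (Sum.inr v : Place K)) 1 →+
      galoisCohomology ((((W.baseChange K).torsionGaloisModule n).tateDual N).toLocal
        (Sum.inr w : Place K)) 1 :=
  semilinearLocalH (ρ := ((W.baseChange K).torsionGaloisModule n).tateDual N)
    (E := v.adicCompletion K) (E' := w.adicCompletion K)
    (isLiftOfAut_liftAutPlace σ h)
    (isLiftOfRingEquiv_ringEquivLift (galAdicCompletionEquiv (L := K) σ h))
    (liftsCommute_liftAutPlace σ h) (tateDualTorsionSemilinearMap W σ n N (isLiftOfAut_liftAutPlace σ h))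
    (isSemilinear_tateDualTorsion W σ n N (isLiftOfAut_liftAutPlace σ h)) 1

omit [Finite (geomTorsion (W.baseChange K) n)] in
/-- `conjActPlace` is the semilinear local action for `ψ = τ` on points (definitional bridge to
`SemilinearLocalCohomology`). [cite: CasselsFrohlichANT1967, Ch. VII §1.1] -/
theorem conjActPlace_eq_semilinearLocalH {v w : HeightOneSpectrum (𝓞 K)} (h : σ • v = w) :
    conjActPlace W σ n h =
      semilinearLocalH (ρ := (W.baseChange K).torsionGaloisModule n)
        (E := v.adicCompletion K) (E' := w.adicCompletion K) (isLiftOfAut_liftAutPlace σ h)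
        (isLiftOfRingEquiv_ringEquivLift (galAdicCompletionEquiv (L := K) σ h))
        (liftsCommute_liftAutPlace σ h) ((isLiftOfAut_liftAutPlace σ h).torsionMap W n)
        ((isLiftOfAut_liftAutPlace σ h).torsionMap_smul W n) 1 := rfl

/-! ### Compatibility of the local Tate pairing with `σ_*` -/

/-- **Compatibility of a family of local invariant maps with `σ_*`**: `inv_w (σ_* c) = inv_v c` for
`c ∈ H²(K_v, μ_N)` and every place datum `σ • v = w`. For THE invariant maps of local class field
theory this is the functoriality of `inv` under isomorphisms of local fields (Serre in
Cassels–Fröhlich, Ch. VI §1.1); the tree's `LocalInvariants` being an abstract family, it is a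
property to assume alongside `IsPerfect`, `SumLocalTermEqZero`. A deliberate dot-notation extension
of `LocalInvariants`. [cite: CasselsFrohlichANT1967, Ch. VI §1.1 (functoriality of `inv`)] -/
def _root_.Literature.NumberTheory.GaloisCohomology.LocalInvariants.IsConjCompatible
    {N : ℕ} (inv : LocalInvariants K N) : Prop :=
  ∀ (v w : HeightOneSpectrum (𝓞 K)) (h : σ • v = w)
    (c : galoisCohomology ((mu K N).toLocal (Sum.inr v : Place K)) 2),
    inv (Sum.inr w) (muConjPlace σ N h 2 c) = inv (Sum.inr v) c

/-- **`⟨σ_* x, σ_* y⟩_w = ⟨x, y⟩_v` for the local Tate pairing `⟨x, y⟩_v = inv_v (x ∪ y)` of `E[n]`**,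
for a family of invariant maps compatible with `σ_*`: `σ_*(x ∪ y) = σ_* x ∪ σ_* y`
(`semilinearLocalH_cupProduct` with the evaluation pairing, `tateDualEval_semilinear`) and
`inv_w ∘ σ_* = inv_v`. This is the per-place adjointness `hb` of the sign-by-sign Poitou–Tate
counting (`sum_pairing_piTransport`): Jetchev 2008 Thm. 5.1 «exact orthogonal complements with
respect to `∑_v ⟨,⟩_v^±`». [cite: Jetchev2008, §5 Thm. 5.1] [cite: MilneADT2006, Ch. I, Cor. 2.3] -/
theorem localTatePairingZMod_conjActPlace (inv : LocalInvariants K N)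
    (hinv : inv.IsConjCompatible σ) {v w : HeightOneSpectrum (𝓞 K)} (h : σ • v = w)
    (x : galoisCohomology (((W.baseChange K).torsionGaloisModule n).toLocal (Sum.inr v : Place K)) 1)
    (y : galoisCohomology ((((W.baseChange K).torsionGaloisModule n).tateDual N).toLocal
      (Sum.inr v : Place K)) 1) :
    localTatePairingZMod ((W.baseChange K).torsionGaloisModule n) N (Sum.inr w : Place K)
        (inv (Sum.inr w)) (conjActPlace W σ n h x) (conjActPlaceDual W σ n N h y) =
      localTatePairingZMod ((W.baseChange K).torsionGaloisModule n) N (Sum.inr v : Place K)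
        (inv (Sum.inr v)) x y := by
  haveI : CompactSpace (absoluteGaloisGroup (v.adicCompletion K)) :=
    absoluteGaloisGroup_compactSpace _
  haveI : CompactSpace (absoluteGaloisGroup (w.adicCompletion K)) :=
    absoluteGaloisGroup_compactSpace _
  have key := semilinearLocalH_cupProduct (ρ := (W.baseChange K).torsionGaloisModule n)
    (ρN := ((W.baseChange K).torsionGaloisModule n).tateDual N) (ρP := mu K N)
    (E := v.adicCompletion K) (E' := w.adicCompletion K) (isLiftOfAut_liftAutPlace σ h)
    (isLiftOfRingEquiv_ringEquivLift (galAdicCompletionEquiv (L := K) σ h))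
    (liftsCommute_liftAutPlace σ h) (tateDualEval K (geomTorsion (W.baseChange K) n) N)
    (DiscreteGaloisModule.tateDualEval_smul ((W.baseChange K).torsionGaloisModule n) N)
    ((isLiftOfAut_liftAutPlace σ h).torsionMap W n) ((isLiftOfAut_liftAutPlace σ h).torsionMap_smul W n)
    (tateDualTorsionSemilinearMap W σ n N (isLiftOfAut_liftAutPlace σ h))
    (isSemilinear_tateDualTorsion W σ n N (isLiftOfAut_liftAutPlace σ h))
    (muSemilinearMap (liftAutPlace σ h) N) (isSemilinear_mu (isLiftOfAut_liftAutPlace σ h) N)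
    (fun m f => tateDualEval_semilinear ((isLiftOfAut_liftAutPlace σ h).torsionMap_symm_apply W n)
      _ m f) x y
  rw [DiscreteGaloisModule.localTatePairingZMod_apply, DiscreteGaloisModule.localTatePairingZMod_apply,
    ← hinv v w h]
  exact congrArg (inv (Sum.inr w)) key.symm

/-! ### Round trip on the dual side -/

/-- **Round trip on `H¹(K_v, E[n]^D)`** for `σ² = 1`: `σ_* ∘ σ_* = id`
(`semilinearLocalH_one_semilinearLocalH_one`; the composition law of `f ↦ τ ∘ f ∘ τ⁻¹` from those of
`τ` on `μ_N` and on points). [cite: SerreLocalFields1979, VII.§5 Prop. 3] -/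
theorem conjActPlaceDual_conjActPlaceDual (hσ : σ * σ = 1) {v w : HeightOneSpectrum (𝓞 K)}
    (h : σ • v = w) (h' : σ • w = v)
    (y : galoisCohomology ((((W.baseChange K).torsionGaloisModule n).tateDual N).toLocal
      (Sum.inr v : Place K)) 1) :
    conjActPlaceDual W σ n N h' (conjActPlaceDual W σ n N h y) = y := by
  refine semilinearLocalH_one_semilinearLocalH_one (E := v.adicCompletion K)
    (E' := w.adicCompletion K) _ _ _ _ _ _ _ _ _ _
    (galAdicCompletionEquiv_galAdicCompletionEquiv_of_mul_self σ hσ h h') ?_ y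
  intro γ hγ f
  exact tateDualSemilinearMap_comp (ρ := (W.baseChange K).torsionGaloisModule n)
    (muSemilinearMap_comp N hγ)
    (inv_comp_inv_eq_of_comp_eq (ρ := (W.baseChange K).torsionGaloisModule n)
      ((isLiftOfAut_liftAutPlace σ h).torsionMap_symm_apply W n)
      ((isLiftOfAut_liftAutPlace σ h').torsionMap_symm_apply W n)
      ((isLiftOfAut_liftAutPlace σ h).torsionMap_comp_eq_apply W (isLiftOfAut_liftAutPlace σ h') n
        γ hγ)) f

/-! ### The global action on `H¹(K, E[n]^D)` and compatibility with localisation -/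

/-- **`σ_*` on `H¹(K, E[n]^D)`**: the semilinear action for the chosen lift `liftAut σ` acting by
`f ↦ τ ∘ f ∘ τ⁻¹` (independent of the lift, `semilinearH_one_eq_of_divGal`). The `Gal(K/ℚ)`-action
on the dual side of `H¹(K, E[p^m]) × H¹(K, E[p^m]^D)` (Jetchev 2008 §5; Gross 1991 §5).
[cite: Jetchev2008, §5 Thm. 5.1] [cite: GrossLMS1991, §5 (5.1)] -/
def conjActDual :
    galoisCohomology (((W.baseChange K).torsionGaloisModule n).tateDual N) 1 →+
      galoisCohomology (((W.baseChange K).torsionGaloisModule n).tateDual N) 1 :=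
  semilinearH (isLiftOfAut_liftAut σ) (tateDualTorsionSemilinearMap W σ n N (isLiftOfAut_liftAut σ))
    (isSemilinear_tateDualTorsion W σ n N (isLiftOfAut_liftAut σ)) 1

/-- Changing the lift on `E[n]^D`: `ψ^D_{τ₁} f = ψ^D_{τ₂} (ρ^D(δ) f)` with `δ = τ₂⁻¹ τ₁`
(the hypothesis `h12` of `semilinearH_one_eq_of_divGal`). [cite: MilneADT2006, Ch. I §0] -/
theorem tateDualTorsionSemilinearMap_eq_of_divGal {τ₁ τ₂ : AlgebraicClosure K ≃+* AlgebraicClosure K}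
    (hτ₁ : IsLiftOfAut σ τ₁) (hτ₂ : IsLiftOfAut σ τ₂)
    (f : TateDual K (geomTorsion (W.baseChange K) n) N) :
    tateDualTorsionSemilinearMap W σ n N hτ₁ f =
      tateDualTorsionSemilinearMap W σ n N hτ₂
        ((((W.baseChange K).torsionGaloisModule n).tateDual N) (hτ₁.divGal hτ₂) f) := by
  refine DiscreteGaloisModule.TateDual.ext fun m => ?_
  change muSemilinearMap τ₁ N (f _) = muSemilinearMap τ₂ N ((((W.baseChange K).torsionGaloisModule
    n).tateDual N (hτ₁.divGal hτ₂) f) _)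
  rw [DiscreteGaloisModule.tateDual_apply_apply_apply]
  -- `τ₁ ζ = τ₂ (δ ζ)` on `μ_N`
  have hμ : ∀ ζ : MuCarrier K N, muSemilinearMap τ₁ N ζ =
      muSemilinearMap τ₂ N (mu K N (hτ₁.divGal hτ₂) ζ) := by
    intro ζ
    apply MuCarrier.eq_of_coe_eq
    rw [coe_muSemilinearMap, coe_muSemilinearMap, coe_mu_apply]
    change τ₁ _ = τ₂ (τ₂.symm (τ₁ _))
    rw [RingEquiv.apply_symm_apply]
  -- `τ₁⁻¹ m = δ⁻¹ (τ₂⁻¹ m)` on points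
  have hm : hτ₁.symm_isLiftOfAut.torsionMap W n m =
      ((W.baseChange K).torsionGaloisModule n) (hτ₁.divGal hτ₂)⁻¹
        (hτ₂.symm_isLiftOfAut.torsionMap W n m) := by
    rw [WeierstrassCurve.torsionGaloisModule_apply_apply]
    apply Subtype.ext
    change hτ₁.symm_isLiftOfAut.pointsMap W m =
      (hτ₁.divGal hτ₂)⁻¹ • hτ₂.symm_isLiftOfAut.pointsMap W (m : geomPoints _)
    generalize (m : geomPoints (W.baseChange K)) = R
    change ((W.baseChange K).baseChange (AlgebraicClosure K)).toAffine.Point at R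
    rcases R with _ | ⟨x, y, hxy⟩
    · rfl
    · exact Affine.Point.some_eq_some_of_eq
        (show τ₁.symm x = τ₁.symm (τ₂ (τ₂.symm x)) by rw [RingEquiv.apply_symm_apply])
        (show τ₁.symm y = τ₁.symm (τ₂ (τ₂.symm y)) by rw [RingEquiv.apply_symm_apply])
  rw [hμ, hm]

/-- **`σ_* (loc_v y) = loc_w (σ_* y)` on the dual side**: `conjActPlaceDual` intertwines the
localisation maps of `E[n]^D` with the global action `conjActDual` (`semilinearLocalH_res` for the
place lift, then independence of the lift). [cite: Jetchev2008, §5 Thm. 5.1] -/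
theorem conjActPlaceDual_localization {v w : HeightOneSpectrum (𝓞 K)} (h : σ • v = w)
    (y : galoisCohomology (((W.baseChange K).torsionGaloisModule n).tateDual N) 1) :
    conjActPlaceDual W σ n N h (galoisCohomology.localization
        (((W.baseChange K).torsionGaloisModule n).tateDual N) (Sum.inr v : Place K) 1 y) =
      galoisCohomology.localization (((W.baseChange K).torsionGaloisModule n).tateDual N)
        (Sum.inr w : Place K) 1 (conjActDual W σ n N y) := by
  have h1 := semilinearLocalH_res (E := v.adicCompletion K) (E' := w.adicCompletion K)
    (isLiftOfAut_liftAutPlace σ h)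
    (isLiftOfRingEquiv_ringEquivLift (galAdicCompletionEquiv (L := K) σ h))
    (liftsCommute_liftAutPlace σ h) (tateDualTorsionSemilinearMap W σ n N (isLiftOfAut_liftAutPlace σ h))
    (isSemilinear_tateDualTorsion W σ n N (isLiftOfAut_liftAutPlace σ h)) 1 y
  rw [semilinearH_one_eq_of_divGal (isLiftOfAut_liftAutPlace σ h) (isLiftOfAut_liftAut σ)
    (isSemilinear_tateDualTorsion W σ n N (isLiftOfAut_liftAutPlace σ h))
    (isSemilinear_tateDualTorsion W σ n N (isLiftOfAut_liftAut σ))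
    (tateDualTorsionSemilinearMap_eq_of_divGal W σ n N _ _)] at h1
  exact h1

end Places

end Literature.NumberTheory.EllipticCurves

end
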